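import Summits.QuantumFields.BalabanUV.Beta.GAN24.CapacitanceRate
import Summits.QuantumFields.BalabanUV.Beta.GAN24.CapacitanceEndpoint
import Summits.QuantumFields.BalabanUV.Beta.GAN24.CapacitanceScalarRateBox

/-!
# `BalabanUV.Beta.GAN24.CapacitanceRateDictionary` — binder row G-an2-4 / (CONV-C), road P1-fibre, leaf **P1-L11** `FibreRate` (Part B), PART 2/3 of the
# «L11 CAPACITANCE HALF»: the DICTIONARY leaf-12 (`capDiag/capBorder/capH`) ↔ leaf-07 (unit-normalised `aT/sT`) and the SCALED ENDPOINT `N^{D+4}·(cap N p)⁻¹`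

NOT IN PRINT; OUR PROOF ATTEMPT.  HONEST FRAMING (cell contract, verbatim): «discharging `BetaPertH` makes Bałaban's UV stability UNCONDITIONAL — a real
constructive-QFT result; it is NOT the continuum limit and NOT the Clay problem.»  HONEST DEPENDENCY (verbatim): «continuum YM on T⁴ ⇐ BetaPertH ∧ nine spine
estimates (0/9 proved); BetaPertH ⇐ (D1) ∧ (D4) ∧ CAP+tail; G-an2-4 gates asym, D1 and NE2/3/4.»  [folklore] bookkeeping between the cell's landed real currencies + leaf-02's/leaf-12's/leaf-14's landed
algebra BY NAME; no cited fact, no wall binder, no `def`, no `def … : Prop` hypothesis, no cancellation.  NOT summit progress: it discharges NOTHING of (CONV-C)'s K-slot `GAN24.CombesThomas.ConvCK 3 Lc` by itself (this is one input of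
row L11 = shape (I2′) of the carver's ASSEMBLY.md §II.3; L10 = (I3′) and L12 are separate); 0 wall binders instantiated; NOT `BetaPertH`, NOT continuum, NOT Clay.
Unit `b2b-balaban-gan24-formalise-leaf-20` (G-an2-4 formalisation swarm, leaf prover 20), 2026-08-20.  Value = kernel assembly leaf toward the K-slot route P1,
NOT summit progress.

## What is proved (every `D`, `N ≥ 1`; §3b–§3d at real `q ∈ [−π, π]^D ∖ {0}`, `p = ofRealVec q`, `|q|² = momSq q`)
* §3a `aw N x = gNormSq N x/N²` (`rfl`), `blockWt = N^D·Π aw`, **`capDiag N p κ = N^{D+4}·aT N p κ`**, **`capBorder N p = N^{D+4}·sT N p`** (every real `p`),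
  the `ℂ`-casts, and the UNIT-NORMALISED BLOCKS `invPP (↑aT) δ δ' = N^{D+4}·invPP (↑capDiag) δ δ'` (leaf-02's `invPP_div`), likewise `invPc/invcP` (every
  `δ, δ'`) and `invcc` (on the punctured zone), `hSum (↑aT) (dhat p) (dflat p) = ↑(N^{D+4}·capH N q)`;
* §3b positivity `aT_pos`, `sT_pos`, `nonvanishing_aT`, the N-UNIFORM unit-normalised BLOCK BOUNDS `‖invPP (↑aT) …‖ ≤ cPP D·|q|²`,
  `‖invPc/invcP (↑aT) … (↑sT)‖ ≤ cPc D·|q|²√|q|²`, `‖invcc …‖ ≤ ccc D·|q|⁴` (L08 BY NAME), and the N-UNIFORM unit-normalised hypotheses of `CapacitanceClosedForm` §6: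
  **`‖(↑ã_κ)⁻¹‖ ≤ 2(π²/4)^{D+1}|q|²`**, **`‖(↑σ̃)⁻¹‖ ≤ (π²/4)^D|q|⁴`**, **`‖(hSum ↑ã …)⁻¹‖ ≤ (π²/4)·gFac D |q|²/|q|⁴`** (from part 1/2 of L08,
  `CapacitanceEndpointBlocks.inv_capDiag_le'/inv_capBorder_le'/inv_capH_le'`);
* §3c **THE SCALED ENDPOINT**: `(N^{D+4} : ℂ)·(cap N p)⁻¹ (inl κ) (inl l) = invPP (↑aT N q) (dhat p) (dflat p) κ l` and the three other blocks with `↑sT N q`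
  (L08's `CapacitanceEndpoint` + leaf-02's `cap_inv_*` + leaf-12's `aDiag_fibreAl/sigma_fibreAl` BY NAME).
-/

noncomputable section

open Complex Finset
open scoped BigOperators Real

namespace Summit.QuantumFields.BalabanUV.Beta.GAN24.CapacitanceRateDictionary

open Literature.MathematicalPhysics.QuantumFieldTheory.Balaban1983to89.B4Strip (ofRealVec)
open Literature.MathematicalPhysics.QuantumFieldTheory.King1986 (momSq momSq_nonneg)
open FibreSymbols (dhat dflat)
open CapacitanceClosedForm (hSum invPP invPc invcP invcc aDiag sigma)
open CapacitanceClosedFormScaling (hSum_div invPP_div)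
open CapacitanceRate (invPc_div_div invcP_div_div invcc_div_div)
open AliasWeights (kfine)
open AliasWeightsSum (lapR)
open CapacitanceScalarBounds (gNormSq blockWt capDiag capDiag_pos momSq_pos)
open CapacitanceScalarBoundsBorder (capBorder capH capBorder_pos capH_pos)
open CapacitanceScalarDictionary (norm_inv_ofReal_of_pos)
open CapacitanceScalarRate (aw)
open CapacitanceScalarRateBox (aT sT)
open CapacitanceEndpointBlocks (gFac cPP cPc ccc inv_capDiag_le' inv_capBorder_le' inv_capH_le' hSum_capDiag_eq)
open CapacitanceEndpoint (nonvanishing_fibreAl aDiag_fibreAl_eq)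
open AliasObjects (cap)

variable {D : ℕ}

/-! ## §3 Dictionary: leaf-12's `capDiag/capBorder/capH` are `N^{D+4}` × leaf-07's unit-normalised scalars; the scaled blocks -/

section dictionary
variable {N : ℕ} [NeZero N]

omit [NeZero N] in
/-- [folklore] leaf-07's normalised one-coordinate weight is leaf-12's squared geometric sum over `N²`: `aw N x = gNormSq N x / N²` (`rfl`). -/
theorem aw_eq_gNormSq_div (x : ℝ) : aw N x = gNormSq N x / (N : ℝ) ^ 2 := rfl

omit [NeZero N] in
/-- [folklore] `blockWt N p m = N^D · Π_i aw N k_{m,i}` (`N ≥ 1`). -/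
theorem blockWt_eq_mul_prod_aw (hN : 1 ≤ N) (p : Fin D → ℝ) (m : Fin D → ZMod N) :
    blockWt N p m = (N : ℝ) ^ D * ∏ i, aw N (kfine N p m i) := by
  have hN0 : (N : ℝ) ≠ 0 := by exact_mod_cast (by omega : N ≠ 0)
  simp only [aw_eq_gNormSq_div]
  unfold CapacitanceScalarBounds.blockWt
  rw [Finset.prod_div_distrib, Finset.prod_const, Finset.card_univ, Fintype.card_fin]
  field_simp
  ring

/-- **DICTIONARY `a_κ = N^{D+4}·ã_κ`** [folklore]: `capDiag N p κ = N^{D+4} · aT N p κ` (every real `p`, `N ≥ 1`). -/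
theorem capDiag_eq_mul_aT (hN : 1 ≤ N) (p : Fin D → ℝ) (κ : Fin D) : capDiag N p κ = (N : ℝ) ^ (D + 4) * aT N p κ := by
  have hN0 : (N : ℝ) ≠ 0 := by exact_mod_cast (by omega : N ≠ 0)
  unfold CapacitanceScalarBounds.capDiag CapacitanceScalarRateBox.aT
  rw [Finset.mul_sum]
  refine Finset.sum_congr rfl fun m _ => ?_
  rw [blockWt_eq_mul_prod_aw hN, aw_eq_gNormSq_div (kfine N p m κ)]
  by_cases hL : lapR (kfine N p m) = 0
  · simp [hL]
  · field_simp
    ring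

/-- **DICTIONARY `σ = N^{D+4}·σ̃`** [folklore]: `capBorder N p = N^{D+4} · sT N p` (every real `p`, `N ≥ 1`). -/
theorem capBorder_eq_mul_sT (hN : 1 ≤ N) (p : Fin D → ℝ) : capBorder N p = (N : ℝ) ^ (D + 4) * sT N p := by
  have hN0 : (N : ℝ) ≠ 0 := by exact_mod_cast (by omega : N ≠ 0)
  unfold CapacitanceScalarBoundsBorder.capBorder CapacitanceScalarRateBox.sT
  rw [Finset.mul_sum]
  refine Finset.sum_congr rfl fun m _ => ?_
  rw [blockWt_eq_mul_prod_aw hN]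
  by_cases hL : lapR (kfine N p m) = 0
  · simp [hL]
  · field_simp
    ring

/-- [folklore] In `ℂ`: `↑(aT N p κ) = ↑(capDiag N p κ) / N^{D+4}`. -/
theorem aTC_eq (hN : 1 ≤ N) (p : Fin D → ℝ) (κ : Fin D) :
    ((aT N p κ : ℝ) : ℂ) = (capDiag N p κ : ℂ) / ((N : ℂ) ^ (D + 4)) := by
  have hN0 : (N : ℂ) ≠ 0 := by exact_mod_cast (by omega : N ≠ 0)
  rw [capDiag_eq_mul_aT hN, Complex.ofReal_mul]
  push_cast
  field_simp

/-- [folklore] In `ℂ`: `↑(sT N p) = ↑(capBorder N p) / N^{D+4}`. -/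
theorem sTC_eq (hN : 1 ≤ N) (p : Fin D → ℝ) : ((sT N p : ℝ) : ℂ) = (capBorder N p : ℂ) / ((N : ℂ) ^ (D + 4)) := by
  have hN0 : (N : ℂ) ≠ 0 := by exact_mod_cast (by omega : N ≠ 0)
  rw [capBorder_eq_mul_sT hN, Complex.ofReal_mul]
  push_cast
  field_simp

/-- [folklore] As functions: `(↑aT N p) = fun κ => ↑(capDiag N p κ) / N^{D+4}`. -/
theorem aTC_fun_eq (hN : 1 ≤ N) (p : Fin D → ℝ) :
    (fun κ => ((aT N p κ : ℝ) : ℂ)) = fun κ => (capDiag N p κ : ℂ) / ((N : ℂ) ^ (D + 4)) :=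
  funext fun κ => aTC_eq hN p κ

/-- **THE UNIT-NORMALISED `φφ` BLOCK** [folklore]: `invPP (↑ã) δ δ' κ l = N^{D+4} · invPP (↑a) δ δ' κ l` (leaf-02's `invPP_div` BY NAME). -/
theorem invPP_aT (hN : 1 ≤ N) (p : Fin D → ℝ) (δ δ' : Fin D → ℂ) (κ l : Fin D) :
    invPP (fun κ => ((aT N p κ : ℝ) : ℂ)) δ δ' κ l = (N : ℂ) ^ (D + 4) * invPP (fun κ => (capDiag N p κ : ℂ)) δ δ' κ l := by
  have hM : (N : ℂ) ^ (D + 4) ≠ 0 := pow_ne_zero _ (by exact_mod_cast (by omega : N ≠ 0))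
  rw [aTC_fun_eq hN, invPP_div _ δ δ' hM]

/-- **THE UNIT-NORMALISED `φc` COLUMN** [folklore]: `invPc (↑ã) δ δ' (↑σ̃) κ = N^{D+4} · invPc (↑a) δ δ' (↑σ) κ`. -/
theorem invPc_aT (hN : 1 ≤ N) (p : Fin D → ℝ) (δ δ' : Fin D → ℂ) (κ : Fin D) :
    invPc (fun κ => ((aT N p κ : ℝ) : ℂ)) δ δ' (sT N p : ℂ) κ
      = (N : ℂ) ^ (D + 4) * invPc (fun κ => (capDiag N p κ : ℂ)) δ δ' (capBorder N p : ℂ) κ := by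
  have hM : (N : ℂ) ^ (D + 4) ≠ 0 := pow_ne_zero _ (by exact_mod_cast (by omega : N ≠ 0))
  rw [aTC_fun_eq hN, sTC_eq hN, invPc_div_div _ δ δ' _ hM]

/-- **THE UNIT-NORMALISED `cφ` ROW** [folklore]: `invcP (↑ã) δ δ' (↑σ̃) l = N^{D+4} · invcP (↑a) δ δ' (↑σ) l`. -/
theorem invcP_aT (hN : 1 ≤ N) (p : Fin D → ℝ) (δ δ' : Fin D → ℂ) (l : Fin D) :
    invcP (fun κ => ((aT N p κ : ℝ) : ℂ)) δ δ' (sT N p : ℂ) l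
      = (N : ℂ) ^ (D + 4) * invcP (fun κ => (capDiag N p κ : ℂ)) δ δ' (capBorder N p : ℂ) l := by
  have hM : (N : ℂ) ^ (D + 4) ≠ 0 := pow_ne_zero _ (by exact_mod_cast (by omega : N ≠ 0))
  rw [aTC_fun_eq hN, sTC_eq hN, invcP_div_div _ δ δ' _ hM]

/-- **THE UNIT-NORMALISED `cc` CORNER** [folklore] on the punctured real zone (`σ, h ≠ 0` there):
`invcc (↑ã) (dhat p) (dflat p) (↑σ̃) = N^{D+4} · invcc (↑a) (dhat p) (dflat p) (↑σ)`. -/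
theorem invcc_aT (hN : 1 ≤ N) {q : Fin D → ℝ} (hq : ∀ i, |q i| ≤ π) (hq0 : q ≠ 0) :
    invcc (fun κ => ((aT N q κ : ℝ) : ℂ)) (dhat (ofRealVec q)) (dflat (ofRealVec q)) (sT N q : ℂ)
      = (N : ℂ) ^ (D + 4) * invcc (fun κ => (capDiag N q κ : ℂ)) (dhat (ofRealVec q)) (dflat (ofRealVec q)) (capBorder N q : ℂ) := by
  have hM : (N : ℂ) ^ (D + 4) ≠ 0 := pow_ne_zero _ (by exact_mod_cast (by omega : N ≠ 0))
  have hσ : (capBorder N q : ℂ) ≠ 0 := Complex.ofReal_ne_zero.2 (capBorder_pos hN hq hq0).ne'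
  have hh : hSum (fun κ => (capDiag N q κ : ℂ)) (dhat (ofRealVec q)) (dflat (ofRealVec q)) ≠ 0 := by
    rw [hSum_capDiag_eq]; exact Complex.ofReal_ne_zero.2 (capH_pos hN hq hq0).ne'
  rw [aTC_fun_eq hN, sTC_eq hN, invcc_div_div _ _ _ hM hσ hh]

/-- [folklore] The unit-normalised Schur scalar: `hSum (↑ã) (dhat p) (dflat p) = ↑(N^{D+4} · capH N q)`. -/
theorem hSum_aT_eq (hN : 1 ≤ N) (q : Fin D → ℝ) :
    hSum (fun κ => ((aT N q κ : ℝ) : ℂ)) (dhat (ofRealVec q)) (dflat (ofRealVec q)) = (((N : ℝ) ^ (D + 4) * capH N q : ℝ) : ℂ) := by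
  rw [aTC_fun_eq hN, hSum_div, hSum_capDiag_eq]
  push_cast
  ring

/-- [folklore] `0 < ã_κ` on the punctured zone. -/
theorem aT_pos (hN : 1 ≤ N) {q : Fin D → ℝ} (hq : ∀ i, |q i| ≤ π) (hq0 : q ≠ 0) (κ : Fin D) : 0 < aT N q κ := by
  have hN0 : (0 : ℝ) < N := by exact_mod_cast hN
  have h := capDiag_pos hN hq hq0 κ
  rw [capDiag_eq_mul_aT hN] at h
  exact pos_of_mul_pos_right h (pow_nonneg hN0.le _)

/-- [folklore] `0 < σ̃` on the punctured zone. -/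
theorem sT_pos (hN : 1 ≤ N) {q : Fin D → ℝ} (hq : ∀ i, |q i| ≤ π) (hq0 : q ≠ 0) : 0 < sT N q := by
  have hN0 : (0 : ℝ) < N := by exact_mod_cast hN
  have h := capBorder_pos hN hq hq0
  rw [capBorder_eq_mul_sT hN] at h
  exact pos_of_mul_pos_right h (pow_nonneg hN0.le _)

/-- **N-UNIFORM `α̃`** [folklore]: `‖(↑ã_κ)⁻¹‖ ≤ 2(π²/4)^{D+1}·|q|²` (leaf-12's `inv_capDiag_le`, unit-normalised: the `N^{D+4}` is gone). -/
theorem norm_inv_aTC_le (hN : 1 ≤ N) {q : Fin D → ℝ} (hq : ∀ i, |q i| ≤ π) (hq0 : q ≠ 0) (κ : Fin D) :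
    ‖(((aT N q κ : ℝ) : ℂ))⁻¹‖ ≤ 2 * (π ^ 2 / 4) ^ (D + 1) * momSq q := by
  have hN0 : (0 : ℝ) < N := by exact_mod_cast hN
  have hM : (0 : ℝ) < (N : ℝ) ^ (D + 4) := by positivity
  rw [norm_inv_ofReal_of_pos (aT_pos hN hq hq0 κ)]
  have h := inv_capDiag_le' hN hq hq0 κ
  rw [capDiag_eq_mul_aT hN, mul_inv, le_div_iff₀ hM] at h
  have e : ((N : ℝ) ^ (D + 4))⁻¹ * (aT N q κ)⁻¹ * (N : ℝ) ^ (D + 4) = (aT N q κ)⁻¹ := by field_simp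
  linarith [e ▸ h]

/-- **N-UNIFORM `ς̃`** [folklore]: `‖(↑σ̃)⁻¹‖ ≤ (π²/4)^D·|q|⁴`. -/
theorem norm_inv_sTC_le (hN : 1 ≤ N) {q : Fin D → ℝ} (hq : ∀ i, |q i| ≤ π) (hq0 : q ≠ 0) :
    ‖(((sT N q : ℝ) : ℂ))⁻¹‖ ≤ (π ^ 2 / 4) ^ D * momSq q ^ 2 := by
  have hN0 : (0 : ℝ) < N := by exact_mod_cast hN
  have hM : (0 : ℝ) < (N : ℝ) ^ (D + 4) := by positivity
  rw [norm_inv_ofReal_of_pos (sT_pos hN hq hq0)]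
  have h := inv_capBorder_le' hN hq hq0
  rw [capBorder_eq_mul_sT hN, mul_inv, le_div_iff₀ hM] at h
  have e : ((N : ℝ) ^ (D + 4))⁻¹ * (sT N q)⁻¹ * (N : ℝ) ^ (D + 4) = (sT N q)⁻¹ := by field_simp
  linarith [e ▸ h]

/-- **N-UNIFORM `η̃`** [folklore]: `‖(hSum (↑ã) (dhat p) (dflat p))⁻¹‖ ≤ (π²/4)·gFac D |q|²/|q|⁴`. -/
theorem norm_inv_hSum_aTC_le (hN : 1 ≤ N) {q : Fin D → ℝ} (hq : ∀ i, |q i| ≤ π) (hq0 : q ≠ 0) :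
    ‖(hSum (fun κ => ((aT N q κ : ℝ) : ℂ)) (dhat (ofRealVec q)) (dflat (ofRealVec q)))⁻¹‖ ≤ π ^ 2 / 4 * gFac D (momSq q) / momSq q ^ 2 := by
  have hN0 : (0 : ℝ) < N := by exact_mod_cast hN
  have hM : (0 : ℝ) < (N : ℝ) ^ (D + 4) := by positivity
  have hpos : 0 < (N : ℝ) ^ (D + 4) * capH N q := mul_pos hM (capH_pos hN hq hq0)
  rw [hSum_aT_eq hN, norm_inv_ofReal_of_pos hpos]
  have h := inv_capH_le' hN hq hq0
  have hP := momSq_pos hq0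
  rw [mul_inv]
  calc ((N : ℝ) ^ (D + 4))⁻¹ * (capH N q)⁻¹
      ≤ ((N : ℝ) ^ (D + 4))⁻¹ * (π ^ 2 / 4 * (N : ℝ) ^ (D + 4) * gFac D (momSq q) / momSq q ^ 2) :=
        mul_le_mul_of_nonneg_left h (inv_nonneg.2 hM.le)
    _ = π ^ 2 / 4 * gFac D (momSq q) / momSq q ^ 2 := by field_simp

/-- **N-UNIFORM BOUND OF THE UNIT-NORMALISED `φφ` BLOCK** [folklore]: `‖invPP (↑ã) (dhat p) (dflat p) κ l‖ ≤ cPP D·|q|²` (L08 part 1 BY NAME). -/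
theorem norm_invPP_aT_le (hN : 1 ≤ N) {q : Fin D → ℝ} (hq : ∀ i, |q i| ≤ π) (hq0 : q ≠ 0) (κ l : Fin D) :
    ‖invPP (fun κ => ((aT N q κ : ℝ) : ℂ)) (dhat (ofRealVec q)) (dflat (ofRealVec q)) κ l‖ ≤ cPP D * momSq q := by
  have hN0 : (0 : ℝ) < N := by exact_mod_cast hN
  have hM : (0 : ℝ) < (N : ℝ) ^ (D + 4) := by positivity
  rw [invPP_aT hN, norm_mul, norm_pow, Complex.norm_natCast]
  calc (N : ℝ) ^ (D + 4) * ‖invPP (fun κ => (capDiag N q κ : ℂ)) (dhat (ofRealVec q)) (dflat (ofRealVec q)) κ l‖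
      ≤ (N : ℝ) ^ (D + 4) * (cPP D * momSq q / (N : ℝ) ^ (D + 4)) :=
        mul_le_mul_of_nonneg_left (CapacitanceEndpointBlocks.norm_invPP_le hN hq hq0 κ l) hM.le
    _ = cPP D * momSq q := by field_simp

/-- **N-UNIFORM BOUND OF THE UNIT-NORMALISED `φc` COLUMN** [folklore]: `≤ cPc D·|q|²√|q|²`. -/
theorem norm_invPc_aT_le (hN : 1 ≤ N) {q : Fin D → ℝ} (hq : ∀ i, |q i| ≤ π) (hq0 : q ≠ 0) (κ : Fin D) :
    ‖invPc (fun κ => ((aT N q κ : ℝ) : ℂ)) (dhat (ofRealVec q)) (dflat (ofRealVec q)) (sT N q : ℂ) κ‖ ≤ cPc D * (momSq q * Real.sqrt (momSq q)) := by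
  have hN0 : (0 : ℝ) < N := by exact_mod_cast hN
  have hM : (0 : ℝ) < (N : ℝ) ^ (D + 4) := by positivity
  rw [invPc_aT hN, norm_mul, norm_pow, Complex.norm_natCast]
  calc (N : ℝ) ^ (D + 4) * ‖invPc (fun κ => (capDiag N q κ : ℂ)) (dhat (ofRealVec q)) (dflat (ofRealVec q)) (capBorder N q : ℂ) κ‖
      ≤ (N : ℝ) ^ (D + 4) * (cPc D * (momSq q * Real.sqrt (momSq q)) / (N : ℝ) ^ (D + 4)) :=
        mul_le_mul_of_nonneg_left (CapacitanceEndpointBlocks.norm_invPc_le hN hq hq0 κ) hM.le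
    _ = cPc D * (momSq q * Real.sqrt (momSq q)) := by field_simp

/-- **N-UNIFORM BOUND OF THE UNIT-NORMALISED `cφ` ROW** [folklore]: `≤ cPc D·|q|²√|q|²`. -/
theorem norm_invcP_aT_le (hN : 1 ≤ N) {q : Fin D → ℝ} (hq : ∀ i, |q i| ≤ π) (hq0 : q ≠ 0) (l : Fin D) :
    ‖invcP (fun κ => ((aT N q κ : ℝ) : ℂ)) (dhat (ofRealVec q)) (dflat (ofRealVec q)) (sT N q : ℂ) l‖ ≤ cPc D * (momSq q * Real.sqrt (momSq q)) := by
  have hN0 : (0 : ℝ) < N := by exact_mod_cast hN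
  have hM : (0 : ℝ) < (N : ℝ) ^ (D + 4) := by positivity
  rw [invcP_aT hN, norm_mul, norm_pow, Complex.norm_natCast]
  calc (N : ℝ) ^ (D + 4) * ‖invcP (fun κ => (capDiag N q κ : ℂ)) (dhat (ofRealVec q)) (dflat (ofRealVec q)) (capBorder N q : ℂ) l‖
      ≤ (N : ℝ) ^ (D + 4) * (cPc D * (momSq q * Real.sqrt (momSq q)) / (N : ℝ) ^ (D + 4)) :=
        mul_le_mul_of_nonneg_left (CapacitanceEndpointBlocks.norm_invcP_le hN hq hq0 l) hM.le
    _ = cPc D * (momSq q * Real.sqrt (momSq q)) := by field_simp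

/-- **N-UNIFORM BOUND OF THE UNIT-NORMALISED `cc` CORNER** [folklore] (no cancellation): `≤ ccc D·|q|⁴`. -/
theorem norm_invcc_aT_le (hN : 1 ≤ N) {q : Fin D → ℝ} (hq : ∀ i, |q i| ≤ π) (hq0 : q ≠ 0) :
    ‖invcc (fun κ => ((aT N q κ : ℝ) : ℂ)) (dhat (ofRealVec q)) (dflat (ofRealVec q)) (sT N q : ℂ)‖ ≤ ccc D * momSq q ^ 2 := by
  have hN0 : (0 : ℝ) < N := by exact_mod_cast hN
  have hM : (0 : ℝ) < (N : ℝ) ^ (D + 4) := by positivity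
  rw [invcc_aT hN hq hq0, norm_mul, norm_pow, Complex.norm_natCast]
  calc (N : ℝ) ^ (D + 4) * ‖invcc (fun κ => (capDiag N q κ : ℂ)) (dhat (ofRealVec q)) (dflat (ofRealVec q)) (capBorder N q : ℂ)‖
      ≤ (N : ℝ) ^ (D + 4) * (ccc D * momSq q ^ 2 / (N : ℝ) ^ (D + 4)) :=
        mul_le_mul_of_nonneg_left (CapacitanceEndpointBlocks.norm_invcc_le hN hq hq0) hM.le
    _ = ccc D * momSq q ^ 2 := by field_simp

/-- [folklore] The three non-vanishings of the unit-normalised data on the punctured zone. -/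
theorem nonvanishing_aT (hN : 1 ≤ N) {q : Fin D → ℝ} (hq : ∀ i, |q i| ≤ π) (hq0 : q ≠ 0) :
    (∀ κ, ((aT N q κ : ℝ) : ℂ) ≠ 0) ∧ ((sT N q : ℝ) : ℂ) ≠ 0
      ∧ hSum (fun κ => ((aT N q κ : ℝ) : ℂ)) (dhat (ofRealVec q)) (dflat (ofRealVec q)) ≠ 0 := by
  have hN0 : (0 : ℝ) < N := by exact_mod_cast hN
  refine ⟨fun κ => Complex.ofReal_ne_zero.2 (aT_pos hN hq hq0 κ).ne', Complex.ofReal_ne_zero.2 (sT_pos hN hq hq0).ne', ?_⟩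
  rw [hSum_aT_eq hN]
  exact Complex.ofReal_ne_zero.2 (mul_pos (by positivity) (capH_pos hN hq hq0)).ne'

/-- **THE SCALED ENDPOINT, `φφ`** [folklore]: `N^{D+4}·(cap N p)⁻¹ (inl κ) (inl l) = invPP (↑ã) (dhat p) (dflat p) κ l` at `p = ofRealVec q`, `q ≠ 0`. -/
theorem scaled_cap_inv_inl_inl (hN : 1 ≤ N) {q : Fin D → ℝ} (hq : ∀ i, |q i| ≤ π) (hq0 : q ≠ 0) (κ l : Fin D) :
    (N : ℂ) ^ (D + 4) * (cap N (ofRealVec q))⁻¹ (Sum.inl κ) (Sum.inl l)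
      = invPP (fun κ => ((aT N q κ : ℝ) : ℂ)) (dhat (ofRealVec q)) (dflat (ofRealVec q)) κ l := by
  obtain ⟨ha, hσ, hh⟩ := nonvanishing_fibreAl hN hq hq0
  rw [CapacitanceClosedFormAlias.cap_inv_inl_inl N (ofRealVec q) _ ha hσ hh, aDiag_fibreAl_eq hN hq hq0, invPP_aT hN]

/-- **THE SCALED ENDPOINT, `φc`** [folklore]. -/
theorem scaled_cap_inv_inl_inr (hN : 1 ≤ N) {q : Fin D → ℝ} (hq : ∀ i, |q i| ≤ π) (hq0 : q ≠ 0) (κ : Fin D) (u : Unit) :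
    (N : ℂ) ^ (D + 4) * (cap N (ofRealVec q))⁻¹ (Sum.inl κ) (Sum.inr u)
      = invPc (fun κ => ((aT N q κ : ℝ) : ℂ)) (dhat (ofRealVec q)) (dflat (ofRealVec q)) (sT N q : ℂ) κ := by
  obtain ⟨ha, hσ, hh⟩ := nonvanishing_fibreAl hN hq hq0
  rw [CapacitanceClosedFormAlias.cap_inv_inl_inr N (ofRealVec q) _ ha hσ hh κ u, aDiag_fibreAl_eq hN hq hq0,
    CapacitanceScalarDictionary.sigma_fibreAl q, invPc_aT hN]

/-- **THE SCALED ENDPOINT, `cφ`** [folklore]. -/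
theorem scaled_cap_inv_inr_inl (hN : 1 ≤ N) {q : Fin D → ℝ} (hq : ∀ i, |q i| ≤ π) (hq0 : q ≠ 0) (u : Unit) (l : Fin D) :
    (N : ℂ) ^ (D + 4) * (cap N (ofRealVec q))⁻¹ (Sum.inr u) (Sum.inl l)
      = invcP (fun κ => ((aT N q κ : ℝ) : ℂ)) (dhat (ofRealVec q)) (dflat (ofRealVec q)) (sT N q : ℂ) l := by
  obtain ⟨ha, hσ, hh⟩ := nonvanishing_fibreAl hN hq hq0
  rw [CapacitanceClosedFormAlias.cap_inv_inr_inl N (ofRealVec q) _ ha hσ hh u l, aDiag_fibreAl_eq hN hq hq0,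
    CapacitanceScalarDictionary.sigma_fibreAl q, invcP_aT hN]

/-- **THE SCALED ENDPOINT, `cc`** [folklore]. -/
theorem scaled_cap_inv_inr_inr (hN : 1 ≤ N) {q : Fin D → ℝ} (hq : ∀ i, |q i| ≤ π) (hq0 : q ≠ 0) (u u' : Unit) :
    (N : ℂ) ^ (D + 4) * (cap N (ofRealVec q))⁻¹ (Sum.inr u) (Sum.inr u')
      = invcc (fun κ => ((aT N q κ : ℝ) : ℂ)) (dhat (ofRealVec q)) (dflat (ofRealVec q)) (sT N q : ℂ) := by
  obtain ⟨ha, hσ, hh⟩ := nonvanishing_fibreAl hN hq hq0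
  rw [CapacitanceClosedFormAlias.cap_inv_inr_inr N (ofRealVec q) _ ha hσ hh u u', aDiag_fibreAl_eq hN hq hq0,
    CapacitanceScalarDictionary.sigma_fibreAl q, invcc_aT hN hq hq0]

end dictionary

end Summit.QuantumFields.BalabanUV.Beta.GAN24.CapacitanceRateDictionary

end
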